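import Literature.Analysis.Complex.CoordinateDerivatives
import Literature.Analysis.Complex.HolomorphicParametricIntegral
import Literature.Analysis.Distribution.ScaledKernelPairing
import HarnessLib

/-!
# Analytic deconvolution: real analyticity from holomorphic extensions of regularisations with polynomially divergent bounds

Analysis/Complex support file. Let `T ∈ 𝒮'(ℝ^ι)` be a tempered distribution and suppose that its
regularisations `T ∗ Ñ_w` by a family of compactly supported kernels at scale `w ∈ (0, 1]`
(`N_w(y) = w^{-m} N(y/w)`) have, on a fixed real ball `B(x₀, r)`, densities which extend
holomorphically to the fixed complex polydisc `{‖z - x₀‖_∞ < r}` with bounds `C_N w^{-p}` —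
*divergent* as the regularisation is removed, but only polynomially, and on a domain which does
not shrink. **Then `T` itself has a holomorphic density near `x₀`**, with an explicit bound
(`exists_holomorphic_density_of_scaled_regularisations`).

This is the mechanism by which Osterwalder–Schrader (*Axioms for Euclidean Green's functions II*,
Comm. Math. Phys. 42 (1975), Ch. VI.1 "From distributions to functions") pass from the regularised
Schwinger functions `T_k = S_k ∗ k_ρ` — which are matrix elements of the semigroup between genuine
vectors, hence continue analytically with bounds from the linear growth condition E0' that blow up
polynomially in the regularisation — to pointwise bounds on the real-analytic `S_k` themselves
((6.7), (6.13)–(6.16)). OS use that `S_k` is already known to be real analytic (Ch. V.1, through the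
Malgrange–Zerner theorem for distributions) and remove the regularisation by the mean value
property of harmonic functions ((6.1)–(6.4)); the present lemma needs no a priori analyticity and
thus also replaces the distributional form of the flat tube theorem by its tempered form
(`Literature.Analysis.Complex.exists_holomorphic_extension_l1Tube_uniform`).

## The statement

The kernels are indexed by a type `A` (`Nk : A → 𝓢(ℝ^ι)`) carrying a **binary splitting** under
multiplication by the coordinates, `xⱼ Nk(a) = Nk(a') + Nk(a'')` (`(a', a'') = Xs j a`): the model is
the class of tensor products of *pair kernels* `κ₁ ∗ κ₂`, for which
`xⱼ (κ₁ ∗ κ₂) = (xⱼκ₁) ∗ κ₂ + κ₁ ∗ (xⱼκ₂)` (`coordMul_translationAverage_id`); all `Nk a` are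
supported in a fixed ball. For every `a` there are `G a : ℝ → ℂ^ι → ℂ`, jointly continuous on
`(0, 1] × polydisc`, holomorphic in `z`, with `‖G a w z‖ ≤ C a · w^{-p}`, and representing the
regularised distribution: `T(K_{(Nk a)_w} ψ) = ∫ G a w (x) ψ(x) dx` for test functions `ψ` supported
in the real ball (`K_h` the averaging operator `u ↦ ∫ h(y) u(· − y) dy`). If some `Nk a₀` has mass
one, then there is `H` holomorphic on the polydisc of half the radius with
`T(ψ) = ∫ H(x) ψ(x) dx` for `ψ` supported in the real half-ball, and
`‖H‖ ≤ deconvBound Xs C a₀ p r` (an explicit combination of the constants of the `≤ (2|ι|)^{p+1}`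
descendants of `a₀`).

## The proof (Taylor expansion in the scale)

By `KernelScaling`/`ScaledKernelPairing`, `w ↦ T(K_{N_w} ψ)` is smooth on `(0, ∞)` with
`n`-th derivative `(-1)ⁿ ∑_J T(K_{(X_J N)_w} ∂^J ψ)` — no negative powers of `w` appear, because
`∂_w N_w = -∑ⱼ ∂ⱼ((xⱼN)_w)` is a divergence and the derivative passes to `ψ`. By the hypothesis and
`n` integrations by parts (`integral_comp_eRealPt_mul_iteratedLineDerivOp`) this equals
`∫ Eₙ(w, x) ψ(x) dx` with `Eₙ(w, ·) = ∑_{J,σ} D^J (G (descendant) w)` holomorphic and, by the Cauchy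
bounds on a slightly smaller polydisc (`norm_cderivIter_le`), **still `O(w^{-p})`**. Taylor's formula
at `w₀ = 1` to the order `p` with integral remainder (`apply_translationAverage_scaleKernel_eq_taylor`)
therefore expresses `T(K_{N_w} ψ)` as `∫ H_w ψ` with
`H_w = ∑_{n ≤ p} (w-1)ⁿ/n! Eₙ(1, ·) - ∫_w^1 (w-t)ᵖ/p! E_{p+1}(t, ·) dt`, where the remainder
integrand is bounded *uniformly* (`|w - t|ᵖ t^{-p} ≤ 1` for `t ≥ w`). Letting `w → 0⁺`,
`T(K_{N_w} ψ) → T(ψ)` (approximate identity) and `∫ H_w ψ → ∫ H ψ` (dominated convergence), with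
`H = ∑_{n ≤ p} (-1)ⁿ/n! Eₙ(1, ·) - ∫_0^1 (-t)ᵖ/p! E_{p+1}(t, ·) dt` holomorphic (holomorphic
dependence of dominated parameter integrals, `differentiableOn_integral_of_dominated`).

## References

* K. Osterwalder, R. Schrader, *Axioms for Euclidean Green's functions II*, Comm. Math. Phys. 42
  (1975) 281–305, Ch. VI.1, (6.1)–(6.7) and (6.13)–(6.16). [OsterwalderSchraderCMP1975]
* L. Hörmander, *The Analysis of Linear Partial Differential Operators I* (1983), §4.4
  (analyticity of distributions), Thm. 4.4.5.

Everything here is elementary given the cited tree results and tagged folklore.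
-/

noncomputable section

open MeasureTheory Filter Set Metric Complex SchwartzMap intervalIntegral
open scoped Topology LineDeriv Real Nat

namespace Literature.Analysis.Complex

open Literature.Analysis.Distribution Literature.Analysis.FunctionSpaces.SchwartzAverage

variable {ι : Type*} [Fintype ι] [DecidableEq ι]

/-! ### Descendants of a kernel under the binary coordinate splitting -/

/-- The **descendant** of `a` along a multi-index `J : Fin n → ι` and a choice `σ : Fin n → Bool` of
left/right factors: `descend J σ a` picks, at each step (first index first, matching
`iterCoordMul`), the component `σ 0` of `Xs (J 0) (descendant along the tails)`. [folklore] -/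
def descend {A : Type*} (Xs : ι → A → A × A) : {n : ℕ} → (Fin n → ι) → (Fin n → Bool) → A → A
  | 0, _, _, a => a
  | _ + 1, J, σ, a =>
      if σ 0 then (Xs (J 0) (descend Xs (Fin.tail J) (Fin.tail σ) a)).1
      else (Xs (J 0) (descend Xs (Fin.tail J) (Fin.tail σ) a)).2

omit [Fintype ι] [DecidableEq ι] in
/-- Zero depth. [folklore] -/
@[simp]
theorem descend_zero {A : Type*} (Xs : ι → A → A × A) (J : Fin 0 → ι) (σ : Fin 0 → Bool) (a : A) :
    descend Xs J σ a = a := rfl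

omit [Fintype ι] [DecidableEq ι] in
/-- One more step with an explicit first choice. [folklore] -/
theorem descend_cons {A : Type*} (Xs : ι → A → A × A) {n : ℕ} (J : Fin (n + 1) → ι) (b : Bool)
    (σ : Fin n → Bool) (a : A) :
    descend Xs J (Fin.cons b σ) a =
      if b then (Xs (J 0) (descend Xs (Fin.tail J) σ a)).1
      else (Xs (J 0) (descend Xs (Fin.tail J) σ a)).2 := by
  rw [descend, Fin.cons_zero, Fin.tail_cons]

/-- **Sum of the constants over all descendants of depth `n`.** [folklore] -/
def descendSum {A : Type*} (Xs : ι → A → A × A) (C : A → ℝ) (a : A) (n : ℕ) : ℝ :=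
  ∑ J : Fin n → ι, ∑ σ : Fin n → Bool, C (descend Xs J σ a)

omit [DecidableEq ι] in
/-- `descendSum` is nonnegative for nonnegative constants. [folklore] -/
theorem descendSum_nonneg {A : Type*} (Xs : ι → A → A × A) {C : A → ℝ} (hC : ∀ a, 0 ≤ C a) (a : A)
    (n : ℕ) : 0 ≤ descendSum Xs C a n :=
  Finset.sum_nonneg fun _ _ => Finset.sum_nonneg fun _ _ => hC _

/-- **The explicit bound of the analytic deconvolution lemma**: with `s⁻¹ = 2(p+2)/r` the reciprocal
of the Cauchy shrinking step,
`∑_{n ≤ p} s⁻ⁿ/n! · descendSum n + s^{-(p+1)}/p! · descendSum (p+1)`. [folklore] -/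
def deconvBound {A : Type*} (Xs : ι → A → A × A) (C : A → ℝ) (a : A) (p : ℕ) (r : ℝ) : ℝ :=
  ∑ n ∈ Finset.range (p + 1), (2 * (p + 2) / r) ^ n / (n ! : ℝ) * descendSum Xs C a n +
    (2 * (p + 2) / r) ^ (p + 1) / (p ! : ℝ) * descendSum Xs C a (p + 1)

/-! ### The setting -/

section Main

variable {A : Type*} (Nk : A → 𝓢(EuclideanSpace ℝ ι, ℂ)) (Xs : ι → A → A × A)

local notation "Kavg" => translationAverage (ContinuousLinearMap.id ℝ (EuclideanSpace ℝ ι))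
local notation "eb" => EuclideanSpace.basisFun ι ℝ

omit [DecidableEq ι] in
/-- **Iterated coordinate multiplication of a kernel is the sum over its descendants.** [folklore] -/
theorem iterCoordMul_eq_sum_descend
    (hX : ∀ (j : ι) (a : A), coordMul ((eb) j) (Nk a) = Nk (Xs j a).1 + Nk (Xs j a).2) :
    ∀ {n : ℕ} (J : Fin n → ι) (a : A),
      iterCoordMul (eb) J (Nk a) = ∑ σ : Fin n → Bool, Nk (descend Xs J σ a)
  | 0, J, a => by simp
  | n + 1, J, a => by
    rw [iterCoordMul_succ, iterCoordMul_eq_sum_descend hX (Fin.tail J) a, coordMul, map_sum]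
    rw [Fintype.sum_equiv (Fin.consEquiv fun _ => Bool).symm
      (fun σ : Fin (n + 1) → Bool => Nk (descend Xs J σ a))
      (fun q : Bool × (Fin n → Bool) => Nk (descend Xs J (Fin.cons q.1 q.2) a))
      (fun σ => by
        conv_lhs => rw [← (Fin.consEquiv fun _ => Bool).apply_symm_apply σ]
        rfl),
      Fintype.sum_prod_type, Fintype.sum_bool, ← Finset.sum_add_distrib]
    refine Finset.sum_congr rfl fun σ _ => ?_
    rw [descend_cons, descend_cons]
    simp only [if_true]
    exact hX (J 0) _

/-! ### The densities of the scale derivatives -/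

/-- **The density of the `n`-th scale derivative at scale `t`**:
`Eₙ(t, z) = ∑_{J : Fin n → ι} ∑_{σ} D^J (G (descend J σ a₀) t)(z)`. [folklore] -/
def densitySeq (Xs : ι → A → A × A) (G : A → ℝ → (ι → ℂ) → ℂ) (a₀ : A) (n : ℕ) (t : ℝ) (z : ι → ℂ) : ℂ :=
  ∑ J : Fin n → ι, ∑ σ : Fin n → Bool, cderivIter J (G (descend Xs J σ a₀) t) z

variable {T : 𝓢(EuclideanSpace ℝ ι, ℂ) →L[ℂ] ℂ} {G : A → ℝ → (ι → ℂ) → ℂ} {C : A → ℝ}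
  {x₀ : EuclideanSpace ℝ ι} {r : ℝ} {p : ℕ}

/-- The directions of `scaledPairingSeq` for the standard basis are the coordinate vectors. [folklore] -/
theorem basisFun_comp_eq {n : ℕ} (J : Fin n → ι) :
    (fun i => (eb) (J i)) = fun i => EuclideanSpace.single (J i) (1 : ℝ) :=
  funext fun i => by simp

/-- Holomorphy of the densities (any scale in `(0, 1]`). [folklore] -/
theorem differentiableOn_densitySeq
    (hdiff : ∀ a, ∀ w ∈ Ioc (0 : ℝ) 1, DifferentiableOn ℂ (G a w) (ball (eRealPt x₀) r))
    (a₀ : A) (n : ℕ) {t : ℝ} (ht : t ∈ Ioc (0 : ℝ) 1) :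
    DifferentiableOn ℂ (densitySeq Xs G a₀ n t) (ball (eRealPt x₀) r) := by
  unfold densitySeq
  refine DifferentiableOn.fun_sum fun J _ => DifferentiableOn.fun_sum fun σ _ => ?_
  exact differentiableOn_cderivIter J (hdiff _ t ht)

omit [DecidableEq ι] in
/-- Integrability of a density (continuous on the real ball) against a test function supported in it.
[folklore] -/
theorem integrable_comp_eRealPt_mul {F : (ι → ℂ) → ℂ} (hF : ContinuousOn F (ball (eRealPt x₀) r))
    (ψ : 𝓢(EuclideanSpace ℝ ι, ℂ)) (hψ : tsupport (ψ : EuclideanSpace ℝ ι → ℂ) ⊆ Metric.ball x₀ r) :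
    Integrable fun x : EuclideanSpace ℝ ι => F (eRealPt x) * ψ x :=
  Continuous.integrable_of_hasCompactSupport
    (continuous_mul_of_continuousOn_of_tsupport_subset Metric.isOpen_ball
      (hF.comp continuous_eRealPt.continuousOn fun _ hx => eRealPt_mem_ball hx) ψ.continuous hψ)
    ((hasCompactSupport_of_tsupport_subset_ball hψ).mul_left)

/-- **The scale derivatives of the regularised pairing are the pairings with the densities**:
for `t ∈ (0, 1]` and `ψ` supported in the real ball,
`scaledPairingSeq … n t = ∫ Eₙ(t, x) ψ(x) dx` (splitting into descendants, the hypothesis for each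
of them against `∂^J ψ`, and `n` integrations by parts — the signs `(-1)ⁿ (-1)ⁿ` cancel). [folklore] -/
theorem scaledPairingSeq_eq_integral_densitySeq
    (hX : ∀ (j : ι) (a : A), coordMul ((eb) j) (Nk a) = Nk (Xs j a).1 + Nk (Xs j a).2)
    (hdiff : ∀ a, ∀ w ∈ Ioc (0 : ℝ) 1, DifferentiableOn ℂ (G a w) (ball (eRealPt x₀) r))
    (hdens : ∀ a, ∀ w ∈ Ioc (0 : ℝ) 1, ∀ ψ : 𝓢(EuclideanSpace ℝ ι, ℂ),
      tsupport (ψ : EuclideanSpace ℝ ι → ℂ) ⊆ Metric.ball x₀ r →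
        T (Kavg (scaleKernel w (Nk a)) ψ) = ∫ x, G a w (eRealPt x) * ψ x)
    (a₀ : A) (n : ℕ) {t : ℝ} (ht : t ∈ Ioc (0 : ℝ) 1) (ψ : 𝓢(EuclideanSpace ℝ ι, ℂ))
    (hψ : tsupport (ψ : EuclideanSpace ℝ ι → ℂ) ⊆ Metric.ball x₀ r) :
    scaledPairingSeq (eb) T (Nk a₀) ψ n t = ∫ x, densitySeq Xs G a₀ n t (eRealPt x) * ψ x := by
  unfold scaledPairingSeq densitySeq
  have hterm : ∀ J : Fin n → ι,
      T (Kavg (scaleKernel t (iterCoordMul (eb) J (Nk a₀))) (∂^{fun i => (eb) (J i)} ψ)) =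
        (-1 : ℂ) ^ n * ∑ σ : Fin n → Bool, ∫ x, cderivIter J (G (descend Xs J σ a₀) t) (eRealPt x) * ψ x := by
    intro J
    rw [iterCoordMul_eq_sum_descend Nk Xs hX J a₀, scaleKernel_sum, translationAverage_id_sum_kernel,
      map_sum, Finset.mul_sum]
    refine Finset.sum_congr rfl fun σ _ => ?_
    have hsuppJ : tsupport ((∂^{fun i => (eb) (J i)} ψ : 𝓢(EuclideanSpace ℝ ι, ℂ)) :
        EuclideanSpace ℝ ι → ℂ) ⊆ Metric.ball x₀ r :=
      (tsupport_iteratedLineDerivOp_subset _ ψ).trans hψ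
    rw [hdens _ t ht _ hsuppJ, basisFun_comp_eq,
      integral_comp_eRealPt_mul_iteratedLineDerivOp J (hdiff _ t ht) ψ hψ]
  simp_rw [hterm]
  rw [← Finset.mul_sum, ← mul_assoc, ← mul_pow, neg_mul_neg, one_mul, one_pow, one_mul]
  have hint : ∀ (J : Fin n → ι) (σ : Fin n → Bool),
      Integrable fun x : EuclideanSpace ℝ ι => cderivIter J (G (descend Xs J σ a₀) t) (eRealPt x) * ψ x :=
    fun J σ => integrable_comp_eRealPt_mul ((differentiableOn_cderivIter J (hdiff _ t ht)).continuousOn) ψ hψ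
  symm
  simp_rw [Finset.sum_mul]
  rw [integral_finsetSum _ fun J _ => integrable_finsetSum _ fun σ _ => hint J σ]
  exact Finset.sum_congr rfl fun J _ => integral_finsetSum _ fun σ _ => hint J σ

omit [DecidableEq ι] in
/-- The Cauchy shrinking step `s = r / (2(p+2))`: `n ≤ p + 1` steps keep radius `≥ r/2`. [folklore] -/
theorem ball_half_subset_ball_sub (hr : 0 < r) {n : ℕ} (hn : n ≤ p + 1) (z₀ : ι → ℂ) :
    ball z₀ (r / 2) ⊆ ball z₀ (r - n * (r / (2 * (p + 2)))) := by
  refine ball_subset_ball ?_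
  have hn' : (n : ℝ) ≤ p + 1 := by exact_mod_cast hn
  have hp : (0 : ℝ) < p + 2 := by positivity
  rw [show (n : ℝ) * (r / (2 * (p + 2))) = n / (p + 2) * (r / 2) by field_simp]
  have h1 : (n : ℝ) / (p + 2) ≤ (p + 1) / (p + 2) := div_le_div_of_nonneg_right hn' hp.le
  have h2 : ((p : ℝ) + 1) / (p + 2) < 1 := (div_lt_one hp).2 (by linarith)
  nlinarith

/-- **The densities are `O(t^{-p})` on the half polydisc**:
`‖Eₙ(t, z)‖ ≤ descendSum n · (2(p+2)/r)ⁿ · t^{-p}` for `n ≤ p + 1`, `t ∈ (0,1]`, `‖z - x₀‖ < r/2`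
(Cauchy bounds on the polydisc shrunk `n` times by `r/(2(p+2))`). [folklore] -/
theorem norm_densitySeq_le (hr : 0 < r)
    (hdiff : ∀ a, ∀ w ∈ Ioc (0 : ℝ) 1, DifferentiableOn ℂ (G a w) (ball (eRealPt x₀) r))
    (hbd : ∀ a, ∀ w ∈ Ioc (0 : ℝ) 1, ∀ z ∈ ball (eRealPt x₀) r, ‖G a w z‖ ≤ C a * (w ^ p)⁻¹)
    (a₀ : A) {n : ℕ} (hn : n ≤ p + 1) {t : ℝ} (ht : t ∈ Ioc (0 : ℝ) 1) {z : ι → ℂ}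
    (hz : z ∈ ball (eRealPt x₀) (r / 2)) :
    ‖densitySeq Xs G a₀ n t z‖ ≤ descendSum Xs C a₀ n * (2 * (p + 2) / r) ^ n * (t ^ p)⁻¹ := by
  set s : ℝ := r / (2 * (p + 2)) with hs
  have hspos : 0 < s := by positivity
  have hsinv : s⁻¹ = 2 * (p + 2) / r := by rw [hs, inv_div]
  have hz' : z ∈ ball (eRealPt x₀) (r - n * s) := ball_half_subset_ball_sub hr hn _ hz
  unfold densitySeq descendSum
  refine (norm_sum_le _ _).trans ?_
  rw [Finset.sum_mul, Finset.sum_mul]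
  refine Finset.sum_le_sum fun J _ => (norm_sum_le _ _).trans ?_
  rw [Finset.sum_mul, Finset.sum_mul]
  refine Finset.sum_le_sum fun σ _ => ?_
  have h := norm_cderivIter_le hspos J (hdiff (descend Xs J σ a₀) t ht) (hbd (descend Xs J σ a₀) t ht) z hz'
  rw [hsinv] at h
  calc ‖cderivIter J (G (descend Xs J σ a₀) t) z‖ ≤ C (descend Xs J σ a₀) * (t ^ p)⁻¹ * (2 * (p + 2) / r) ^ n := h
    _ = C (descend Xs J σ a₀) * (2 * (p + 2) / r) ^ n * (t ^ p)⁻¹ := by ring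

/-- **Joint continuity of the densities** on `(0, 1] × half polydisc` (`n ≤ p + 1`). [folklore] -/
theorem continuousOn_densitySeq (hr : 0 < r)
    (hcont : ∀ a, ContinuousOn (fun q : ℝ × (ι → ℂ) => G a q.1 q.2) (Ioc 0 1 ×ˢ ball (eRealPt x₀) r))
    (hdiff : ∀ a, ∀ w ∈ Ioc (0 : ℝ) 1, DifferentiableOn ℂ (G a w) (ball (eRealPt x₀) r))
    (a₀ : A) {n : ℕ} (hn : n ≤ p + 1) :
    ContinuousOn (fun q : ℝ × (ι → ℂ) => densitySeq Xs G a₀ n q.1 q.2)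
      (Ioc 0 1 ×ˢ ball (eRealPt x₀) (r / 2)) := by
  have hspos : 0 < r / (2 * (p + 2)) := by positivity
  unfold densitySeq
  refine continuousOn_finsetSum _ fun J _ => continuousOn_finsetSum _ fun σ _ => ?_
  exact (continuousOn_cderivIter_param hspos J (hcont _) (hdiff _)).mono
    (prod_mono subset_rfl (ball_half_subset_ball_sub hr hn _))

/-- Continuity in the scale of a density at a fixed point of the half polydisc. [folklore] -/
theorem continuousOn_densitySeq_left (hr : 0 < r)
    (hcont : ∀ a, ContinuousOn (fun q : ℝ × (ι → ℂ) => G a q.1 q.2) (Ioc 0 1 ×ˢ ball (eRealPt x₀) r))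
    (hdiff : ∀ a, ∀ w ∈ Ioc (0 : ℝ) 1, DifferentiableOn ℂ (G a w) (ball (eRealPt x₀) r))
    (a₀ : A) {n : ℕ} (hn : n ≤ p + 1) {z : ι → ℂ} (hz : z ∈ ball (eRealPt x₀) (r / 2)) :
    ContinuousOn (fun t : ℝ => densitySeq Xs G a₀ n t z) (Ioc 0 1) := by
  have hg := continuousOn_densitySeq Xs hr hcont hdiff a₀ hn
  have hf : ContinuousOn (fun t : ℝ => (t, z)) (Ioc (0 : ℝ) 1) :=
    (continuous_id.prodMk continuous_const).continuousOn
  have hmaps : MapsTo (fun t : ℝ => (t, z)) (Ioc (0 : ℝ) 1) (Ioc 0 1 ×ˢ ball (eRealPt x₀) (r / 2)) :=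
    fun t ht => mk_mem_prod ht hz
  have h := hg.comp hf hmaps
  refine h.congr fun t _ => ?_
  simp only [Function.comp_apply]

/-! ### The Taylor remainder densities -/

/-- The **remainder density** with lower limit `w ∈ [0, 1]`:
`R_w(z) = ∫_{(0,1]} 𝟙_{t > w} (w - t)ᵖ/p! E_{p+1}(t, z) dt` (for `w = 0` the integral term of `H`, up to
sign). [folklore] -/
def remainderDensity (Xs : ι → A → A × A) (G : A → ℝ → (ι → ℂ) → ℂ) (a₀ : A) (p : ℕ) (w : ℝ) (z : ι → ℂ) : ℂ :=
  ∫ t in Ioc (0 : ℝ) 1, (Ioi w).indicator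
    (fun t => ((w : ℂ) - t) ^ p / (p ! : ℂ) * densitySeq Xs G a₀ (p + 1) t z) t

/-- The uniform bound of the remainder integrand: `|w - t|ᵖ t^{-p} ≤ 1` for `0 ≤ w ≤ t`. [folklore] -/
theorem norm_remainder_integrand_le (hr : 0 < r)
    (hdiff : ∀ a, ∀ w ∈ Ioc (0 : ℝ) 1, DifferentiableOn ℂ (G a w) (ball (eRealPt x₀) r))
    (hbd : ∀ a, ∀ w ∈ Ioc (0 : ℝ) 1, ∀ z ∈ ball (eRealPt x₀) r, ‖G a w z‖ ≤ C a * (w ^ p)⁻¹)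
    (hC : ∀ a, 0 ≤ C a) (a₀ : A) {w : ℝ} (hw : 0 ≤ w) {t : ℝ} (ht : t ∈ Ioc (0 : ℝ) 1) {z : ι → ℂ}
    (hz : z ∈ ball (eRealPt x₀) (r / 2)) :
    ‖(Ioi w).indicator (fun t => ((w : ℂ) - t) ^ p / (p ! : ℂ) * densitySeq Xs G a₀ (p + 1) t z) t‖ ≤
      descendSum Xs C a₀ (p + 1) * (2 * (p + 2) / r) ^ (p + 1) / (p ! : ℝ) := by
  set B : ℝ := descendSum Xs C a₀ (p + 1) * (2 * (p + 2) / r) ^ (p + 1) with hB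
  have hB0 : 0 ≤ B := mul_nonneg (descendSum_nonneg Xs hC a₀ _) (by positivity)
  by_cases htw : t ∈ Ioi w
  · rw [indicator_of_mem htw, norm_mul, norm_div, norm_pow, Complex.norm_natCast]
    have hE := norm_densitySeq_le Xs hr hdiff hbd a₀ le_rfl ht hz
    have hwt : ‖(w : ℂ) - t‖ ≤ t := by
      rw [← Complex.ofReal_sub, Complex.norm_real, Real.norm_eq_abs, abs_sub_comm,
        abs_of_nonneg (by linarith [mem_Ioi.1 htw])]
      linarith
    have htp : 0 < t ^ p := pow_pos ht.1 _
    calc ‖(w : ℂ) - t‖ ^ p / (p ! : ℝ) * ‖densitySeq Xs G a₀ (p + 1) t z‖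
        ≤ t ^ p / (p ! : ℝ) * (B * (t ^ p)⁻¹) := by
          refine mul_le_mul (div_le_div_of_nonneg_right (pow_le_pow_left₀ (norm_nonneg _) hwt _)
            (by positivity)) (by rw [hB]; exact hE) (norm_nonneg _) (by positivity)
      _ = B / (p ! : ℝ) := by field_simp
  · rw [indicator_of_notMem htw, norm_zero]
    positivity

/-- Measurability in the scale of the remainder integrand. [folklore] -/
theorem aestronglyMeasurable_remainder_integrand (hr : 0 < r)
    (hcont : ∀ a, ContinuousOn (fun q : ℝ × (ι → ℂ) => G a q.1 q.2) (Ioc 0 1 ×ˢ ball (eRealPt x₀) r))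
    (hdiff : ∀ a, ∀ w ∈ Ioc (0 : ℝ) 1, DifferentiableOn ℂ (G a w) (ball (eRealPt x₀) r))
    (a₀ : A) (w : ℝ) {z : ι → ℂ} (hz : z ∈ ball (eRealPt x₀) (r / 2)) :
    AEStronglyMeasurable (fun t => (Ioi w).indicator
      (fun t => ((w : ℂ) - t) ^ p / (p ! : ℂ) * densitySeq Xs G a₀ (p + 1) t z) t)
      (volume.restrict (Ioc (0 : ℝ) 1)) := by
  refine AEStronglyMeasurable.indicator ?_ measurableSet_Ioi
  refine ContinuousOn.aestronglyMeasurable ?_ measurableSet_Ioc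
  exact (Continuous.continuousOn (by fun_prop)).mul (continuousOn_densitySeq_left Xs hr hcont hdiff a₀ le_rfl hz)

/-- **Holomorphy and bound of the remainder densities** (`w ∈ [0, 1]`): holomorphic dependence of a
dominated parameter integral. [folklore] -/
theorem differentiableOn_remainderDensity (hr : 0 < r)
    (hcont : ∀ a, ContinuousOn (fun q : ℝ × (ι → ℂ) => G a q.1 q.2) (Ioc 0 1 ×ˢ ball (eRealPt x₀) r))
    (hdiff : ∀ a, ∀ w ∈ Ioc (0 : ℝ) 1, DifferentiableOn ℂ (G a w) (ball (eRealPt x₀) r))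
    (hbd : ∀ a, ∀ w ∈ Ioc (0 : ℝ) 1, ∀ z ∈ ball (eRealPt x₀) r, ‖G a w z‖ ≤ C a * (w ^ p)⁻¹)
    (hC : ∀ a, 0 ≤ C a) (a₀ : A) {w : ℝ} (hw : 0 ≤ w) :
    DifferentiableOn ℂ (remainderDensity Xs G a₀ p w) (ball (eRealPt x₀) (r / 2)) := by
  unfold remainderDensity
  refine differentiableOn_integral_of_dominated (fun z hz =>
    aestronglyMeasurable_remainder_integrand Xs hr hcont hdiff a₀ w hz) ?_ fun z₁ hz₁ => ?_
  · rw [ae_restrict_iff' measurableSet_Ioc]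
    refine Eventually.of_forall fun t ht => ?_
    by_cases htw : t ∈ Ioi w
    · simp only [indicator_of_mem htw]
      exact ((differentiableOn_densitySeq Xs hdiff a₀ (p + 1) ht).mono ball_half_subset).const_mul _
    · simp only [indicator_of_notMem htw]
      exact differentiableOn_const 0
  · obtain ⟨R, hR, hRU⟩ := Metric.isOpen_iff.1 isOpen_ball z₁ hz₁
    refine ⟨R, hR, hRU, fun _ => descendSum Xs C a₀ (p + 1) * (2 * (p + 2) / r) ^ (p + 1) / (p ! : ℝ),
      integrableOn_const (measure_Ioc_lt_top (a := (0 : ℝ)) (b := 1)).ne, ?_⟩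
    rw [ae_restrict_iff' measurableSet_Ioc]
    exact Eventually.of_forall fun t ht z hz =>
      norm_remainder_integrand_le Xs hr hdiff hbd hC a₀ hw ht (hRU hz)
  where
    ball_half_subset : ball (eRealPt x₀) (r / 2) ⊆ ball (eRealPt x₀) r := ball_subset_ball (by linarith)

/-- **The bound of the remainder density**: `‖R_w(z)‖ ≤ descendSum (p+1) (2(p+2)/r)^{p+1} / p!`. [folklore] -/
theorem norm_remainderDensity_le (hr : 0 < r)
    (hdiff : ∀ a, ∀ w ∈ Ioc (0 : ℝ) 1, DifferentiableOn ℂ (G a w) (ball (eRealPt x₀) r))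
    (hbd : ∀ a, ∀ w ∈ Ioc (0 : ℝ) 1, ∀ z ∈ ball (eRealPt x₀) r, ‖G a w z‖ ≤ C a * (w ^ p)⁻¹)
    (hC : ∀ a, 0 ≤ C a) (a₀ : A) {w : ℝ} (hw : 0 ≤ w) {z : ι → ℂ} (hz : z ∈ ball (eRealPt x₀) (r / 2)) :
    ‖remainderDensity Xs G a₀ p w z‖ ≤ descendSum Xs C a₀ (p + 1) * (2 * (p + 2) / r) ^ (p + 1) / (p ! : ℝ) := by
  unfold remainderDensity
  refine (norm_setIntegral_le_of_norm_le_const (measure_Ioc_lt_top (a := (0 : ℝ)) (b := 1)) fun t ht =>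
    norm_remainder_integrand_le Xs hr hdiff hbd hC a₀ hw ht hz).trans ?_
  rw [Real.volume_real_Ioc_of_le zero_le_one, sub_zero, mul_one]

omit [DecidableEq ι] in
/-- **Two-variable support trick**: if `f` is continuous on `S ×ˢ U` with `U` open containing the
topological support of the continuous `ψ`, then `(t, x) ↦ f(t, x) ψ(x)` is continuous on `S ×ˢ univ`
(it vanishes near every point with `x ∉ tsupport ψ`). [folklore] -/
theorem continuousOn_mul_of_tsupport_subset {Y Z : Type*} [TopologicalSpace Y] [TopologicalSpace Z]
    {f : Y × Z → ℂ} {ψ : Z → ℂ} {S : Set Y} {U : Set Z} (hU : IsOpen U) (hf : ContinuousOn f (S ×ˢ U))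
    (hψ : Continuous ψ) (hsupp : tsupport ψ ⊆ U) :
    ContinuousOn (fun q : Y × Z => f q * ψ q.2) (S ×ˢ univ) := by
  rintro ⟨t, x⟩ hq
  have ht : t ∈ S := (mem_prod.1 hq).1
  by_cases hx : x ∈ tsupport ψ
  · have hfc : ContinuousWithinAt f (S ×ˢ univ) (t, x) := by
      refine (hf (t, x) (mk_mem_prod ht (hsupp hx))).mono_of_mem_nhdsWithin ?_
      refine mem_nhdsWithin.2 ⟨univ ×ˢ U, isOpen_univ.prod hU, mk_mem_prod (mem_univ _) (hsupp hx), ?_⟩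
      rintro ⟨t', x'⟩ ⟨h1, h2⟩
      exact mk_mem_prod (mem_prod.1 h2).1 (mem_prod.1 h1).2
    exact hfc.mul (hψ.comp continuous_snd).continuousWithinAt
  · have hev : ψ =ᶠ[𝓝 x] 0 := by rwa [← notMem_tsupport_iff_eventuallyEq]
    have hev2 : (fun q : Y × Z => f q * ψ q.2) =ᶠ[𝓝 (t, x)] fun _ => 0 := by
      have h2 : ∀ᶠ q : Y × Z in 𝓝 (t, x), ψ q.2 = 0 :=
        (continuous_snd.tendsto (t, x)).eventually hev
      filter_upwards [h2] with q hq'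
      simp [hq']
    exact (continuousAt_const.congr hev2.symm).continuousWithinAt

/-! ### The analytic deconvolution lemma -/

/-- The polynomial part of the densities `∑_{n ≤ p} (w-1)ⁿ/n! Eₙ(1, z)`. [folklore] -/
def polyDensity (Xs : ι → A → A × A) (G : A → ℝ → (ι → ℂ) → ℂ) (a₀ : A) (p : ℕ) (w : ℝ)
    (z : ι → ℂ) : ℂ :=
  ∑ n ∈ Finset.range (p + 1), ((w : ℂ) - 1) ^ n / (n ! : ℂ) * densitySeq Xs G a₀ n 1 z

/-- Bound of the polynomial part for `w ∈ [0, 1]` on the half polydisc. [folklore] -/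
theorem norm_polyDensity_le (hr : 0 < r)
    (hdiff : ∀ a, ∀ w ∈ Ioc (0 : ℝ) 1, DifferentiableOn ℂ (G a w) (ball (eRealPt x₀) r))
    (hbd : ∀ a, ∀ w ∈ Ioc (0 : ℝ) 1, ∀ z ∈ ball (eRealPt x₀) r, ‖G a w z‖ ≤ C a * (w ^ p)⁻¹)
    (a₀ : A) {w : ℝ} (hw0 : 0 ≤ w) (hw1 : w ≤ 1) {z : ι → ℂ} (hz : z ∈ ball (eRealPt x₀) (r / 2)) :
    ‖polyDensity Xs G a₀ p w z‖ ≤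
      ∑ n ∈ Finset.range (p + 1), (2 * (p + 2) / r) ^ n / (n ! : ℝ) * descendSum Xs C a₀ n := by
  unfold polyDensity
  refine (norm_sum_le _ _).trans (Finset.sum_le_sum fun n hn => ?_)
  rw [Finset.mem_range] at hn
  rw [norm_mul, norm_div, norm_pow, Complex.norm_natCast]
  have hE := norm_densitySeq_le Xs hr hdiff hbd a₀ (by omega : n ≤ p + 1) ⟨zero_lt_one, le_rfl⟩ hz
  rw [one_pow, inv_one, mul_one] at hE
  have hw : ‖(w : ℂ) - 1‖ ≤ 1 := by
    rw [← Complex.ofReal_one, ← Complex.ofReal_sub, Complex.norm_real, Real.norm_eq_abs, abs_sub_comm,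
      abs_of_nonneg (by linarith)]
    linarith
  calc ‖(w : ℂ) - 1‖ ^ n / (n ! : ℝ) * ‖densitySeq Xs G a₀ n 1 z‖
      ≤ 1 / (n ! : ℝ) * (descendSum Xs C a₀ n * (2 * (p + 2) / r) ^ n) := by
        refine mul_le_mul (div_le_div_of_nonneg_right (pow_le_one₀ (norm_nonneg _) hw) (by positivity))
          hE (norm_nonneg _) (by positivity)
    _ = (2 * (p + 2) / r) ^ n / (n ! : ℝ) * descendSum Xs C a₀ n := by ring

/-- **The analytic deconvolution lemma** (module docstring). Let `T ∈ 𝒮'(ℝ^ι)`; let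
`Nk : A → 𝒮(ℝ^ι)` be kernels supported in `B̄(0, R₀)` with a binary splitting `Xs` under
multiplication by the coordinates (`xⱼ Nk a = Nk (Xs j a).1 + Nk (Xs j a).2`); let
`G a : ℝ → ℂ^ι → ℂ` be jointly continuous on `(0,1] × {‖z - x₀‖_∞ < r}`, holomorphic in `z`, bounded by
`C a · w^{-p}` (`C ≥ 0`), and represent the regularisations,
`T(K_{(Nk a)_w} ψ) = ∫ G a w (x) ψ(x) dx` for `ψ` supported in the real ball `B(x₀, r)`; and let
`Nk a₀` have mass one. Then there is `H`, holomorphic on the polydisc `{‖z - x₀‖_∞ < r/2}` and bounded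
there by `deconvBound Xs C a₀ p r`, with `T(ψ) = ∫ H(x) ψ(x) dx` for all `ψ` supported in
`B(x₀, r/2)`: **`T` is (the distribution of) a real-analytic function near `x₀`.** [folklore] -/
theorem exists_holomorphic_density_of_scaled_regularisations
    (hX : ∀ (j : ι) (a : A), coordMul ((eb) j) (Nk a) = Nk (Xs j a).1 + Nk (Xs j a).2)
    (hr : 0 < r) {R₀ : ℝ}
    (hsupp : ∀ a, tsupport (Nk a : EuclideanSpace ℝ ι → ℂ) ⊆ closedBall 0 R₀)
    (hcont : ∀ a, ContinuousOn (fun q : ℝ × (ι → ℂ) => G a q.1 q.2) (Ioc 0 1 ×ˢ ball (eRealPt x₀) r))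
    (hdiff : ∀ a, ∀ w ∈ Ioc (0 : ℝ) 1, DifferentiableOn ℂ (G a w) (ball (eRealPt x₀) r))
    (hbd : ∀ a, ∀ w ∈ Ioc (0 : ℝ) 1, ∀ z ∈ ball (eRealPt x₀) r, ‖G a w z‖ ≤ C a * (w ^ p)⁻¹)
    (hC : ∀ a, 0 ≤ C a)
    (hdens : ∀ a, ∀ w ∈ Ioc (0 : ℝ) 1, ∀ ψ : 𝓢(EuclideanSpace ℝ ι, ℂ),
      tsupport (ψ : EuclideanSpace ℝ ι → ℂ) ⊆ Metric.ball x₀ r →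
        T (Kavg (scaleKernel w (Nk a)) ψ) = ∫ x, G a w (eRealPt x) * ψ x)
    (a₀ : A) (hmass : ∫ x, Nk a₀ x = 1) :
    ∃ H : (ι → ℂ) → ℂ, DifferentiableOn ℂ H (ball (eRealPt x₀) (r / 2)) ∧
      (∀ z ∈ ball (eRealPt x₀) (r / 2), ‖H z‖ ≤ deconvBound Xs C a₀ p r) ∧
      ∀ ψ : 𝓢(EuclideanSpace ℝ ι, ℂ), tsupport (ψ : EuclideanSpace ℝ ι → ℂ) ⊆ Metric.ball x₀ (r / 2) →
        T ψ = ∫ x, H (eRealPt x) * ψ x := by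
  have hball : ball (eRealPt x₀) (r / 2) ⊆ ball (eRealPt x₀) r := ball_subset_ball (by linarith)
  have hrball : Metric.ball x₀ (r / 2) ⊆ Metric.ball x₀ r := Metric.ball_subset_ball (by linarith)
  -- the densities at the scales `w ∈ [0, 1]` and the limit density
  set Hw : ℝ → (ι → ℂ) → ℂ := fun w z => polyDensity Xs G a₀ p w z - remainderDensity Xs G a₀ p w z with hHw
  -- constants
  set Bpoly : ℝ := ∑ n ∈ Finset.range (p + 1), (2 * (p + 2) / r) ^ n / (n ! : ℝ) * descendSum Xs C a₀ n
    with hBpoly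
  set Brem : ℝ := descendSum Xs C a₀ (p + 1) * (2 * (p + 2) / r) ^ (p + 1) / (p ! : ℝ) with hBrem
  have hbound_eq : deconvBound Xs C a₀ p r = Bpoly + Brem := by
    rw [deconvBound, hBpoly, hBrem]; ring
  have hBrem0 : 0 ≤ Brem := by
    rw [hBrem]
    exact div_nonneg (mul_nonneg (descendSum_nonneg Xs hC a₀ _) (by positivity)) (by positivity)
  have hHw_bd : ∀ w, 0 ≤ w → w ≤ 1 → ∀ z ∈ ball (eRealPt x₀) (r / 2), ‖Hw w z‖ ≤ Bpoly + Brem := by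
    intro w hw0 hw1 z hz
    exact (norm_sub_le _ _).trans (add_le_add (norm_polyDensity_le Xs hr hdiff hbd a₀ hw0 hw1 hz)
      (norm_remainderDensity_le Xs hr hdiff hbd hC a₀ hw0 hz))
  refine ⟨Hw 0, ?_, fun z hz => hbound_eq ▸ hHw_bd 0 le_rfl zero_le_one z hz, fun ψ hψ => ?_⟩
  · -- holomorphy
    refine DifferentiableOn.sub ?_ (differentiableOn_remainderDensity Xs hr hcont hdiff hbd hC a₀ le_rfl)
    unfold polyDensity
    refine DifferentiableOn.fun_sum fun n _ => ?_
    exact ((differentiableOn_densitySeq Xs hdiff a₀ n ⟨zero_lt_one, le_rfl⟩).mono hball).const_mul _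
  · -- representation
    have hψr : tsupport (ψ : EuclideanSpace ℝ ι → ℂ) ⊆ Metric.ball x₀ r := hψ.trans hrball
    -- (A) at positive scales, by Taylor's formula and Fubini
    have hA : ∀ w ∈ Ioc (0 : ℝ) 1, T (Kavg (scaleKernel w (Nk a₀)) ψ) = ∫ x, Hw w (eRealPt x) * ψ x := by
      intro w hw
      have ha : ∀ (n : ℕ) (t : ℝ), t ∈ Ioc (0 : ℝ) 1 →
          scaledPairingSeq (eb) T (Nk a₀) ψ n t = ∫ x, densitySeq Xs G a₀ n t (eRealPt x) * ψ x :=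
        fun n t ht => scaledPairingSeq_eq_integral_densitySeq Nk Xs hX hdiff hdens a₀ n ht ψ hψr
      have hintE : ∀ (n : ℕ) (t : ℝ), t ∈ Ioc (0 : ℝ) 1 →
          Integrable fun x : EuclideanSpace ℝ ι => densitySeq Xs G a₀ n t (eRealPt x) * ψ x :=
        fun n t ht => integrable_comp_eRealPt_mul
          ((differentiableOn_densitySeq Xs hdiff a₀ n ht).continuousOn) ψ hψr
      -- the polynomial part
      have hpoly : ∑ n ∈ Finset.range (p + 1), ((w : ℂ) - 1) ^ n / (n ! : ℂ) *
          scaledPairingSeq (eb) T (Nk a₀) ψ n 1 = ∫ x, polyDensity Xs G a₀ p w (eRealPt x) * ψ x := by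
        have hint : ∀ n ∈ Finset.range (p + 1), Integrable fun x : EuclideanSpace ℝ ι =>
            ((w : ℂ) - 1) ^ n / (n ! : ℂ) * densitySeq Xs G a₀ n 1 (eRealPt x) * ψ x := fun n _ => by
          simp_rw [mul_assoc]
          exact (hintE n 1 ⟨zero_lt_one, le_rfl⟩).const_mul _
        unfold polyDensity
        simp_rw [Finset.sum_mul]
        rw [integral_finsetSum _ hint]
        refine Finset.sum_congr rfl fun n _ => ?_
        rw [ha n 1 ⟨zero_lt_one, le_rfl⟩, ← MeasureTheory.integral_const_mul]
        simp_rw [mul_assoc]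
      -- the remainder: Taylor's remainder integrand at scale `t`
      set k : ℝ → ℂ := fun t => ((w : ℂ) - t) ^ p / (p ! : ℂ) with hk
      have hkc : Continuous k := by rw [hk]; fun_prop
      -- Fubini for `(t, x) ↦ k(t) E_{p+1}(t, x) ψ(x)` on `(w, 1] × ℝ^ι`
      set F : ℝ → EuclideanSpace ℝ ι → ℂ := fun t x =>
        k t * (densitySeq Xs G a₀ (p + 1) t (eRealPt x) * ψ x) with hF
      have hset : (volume.restrict (Ioc w 1)).prod (volume : Measure (EuclideanSpace ℝ ι)) =
          ((volume : Measure ℝ).prod (volume : Measure (EuclideanSpace ℝ ι))).restrict (Ioc w 1 ×ˢ univ) := by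
        rw [← Measure.restrict_univ (μ := (volume : Measure (EuclideanSpace ℝ ι))),
          Measure.prod_restrict, Measure.restrict_univ]
      have hFint : Integrable (Function.uncurry F) ((volume.restrict (Ioc w 1)).prod volume) := by
        have hmeas : AEStronglyMeasurable (Function.uncurry F) ((volume.restrict (Ioc w 1)).prod volume) := by
          rw [hset]
          refine ContinuousOn.aestronglyMeasurable ?_ (measurableSet_Ioc.prod MeasurableSet.univ)
          have hf : ContinuousOn (fun q : ℝ × EuclideanSpace ℝ ι =>
              k q.1 * densitySeq Xs G a₀ (p + 1) q.1 (eRealPt q.2)) (Ioc 0 1 ×ˢ Metric.ball x₀ (r / 2)) := by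
            refine (hkc.comp continuous_fst).continuousOn.mul ?_
            have hg := continuousOn_densitySeq Xs hr hcont hdiff a₀ (le_refl (p + 1))
            have hmap : MapsTo (fun q : ℝ × EuclideanSpace ℝ ι => (q.1, eRealPt q.2))
                (Ioc 0 1 ×ˢ Metric.ball x₀ (r / 2)) (Ioc 0 1 ×ˢ ball (eRealPt x₀) (r / 2)) :=
              fun q hq => mk_mem_prod (mem_prod.1 hq).1 (eRealPt_mem_ball (mem_prod.1 hq).2)
            have h := hg.comp (continuous_fst.prodMk (continuous_eRealPt.comp continuous_snd)).continuousOn hmap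
            exact h.congr fun q _ => by simp only [Function.comp_apply]
          have h2 := continuousOn_mul_of_tsupport_subset Metric.isOpen_ball hf ψ.continuous hψ
          refine (h2.mono (prod_mono (Ioc_subset_Ioc_left hw.1.le) subset_rfl)).congr ?_
          rintro ⟨t, x⟩ _
          simp only [hF, Function.uncurry_apply_pair]
          ring
        haveI : IsFiniteMeasure ((volume : Measure ℝ).restrict (Ioc w 1)) :=
          isFiniteMeasure_restrict.2 measure_Ioc_lt_top.ne
        refine Integrable.mono' ((integrable_const Brem).mul_prod ψ.integrable.norm) hmeas ?_
        rw [hset, ae_restrict_iff' (measurableSet_Ioc.prod MeasurableSet.univ)]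
        refine Eventually.of_forall ?_
        rintro ⟨t, x⟩ hq
        have ht : t ∈ Ioc w 1 := (mem_prod.1 hq).1
        have ht' : t ∈ Ioc (0 : ℝ) 1 := ⟨hw.1.trans ht.1, ht.2⟩
        simp only [hF, Function.uncurry_apply_pair]
        by_cases hx : x ∈ Metric.ball x₀ (r / 2)
        · have hb := norm_remainder_integrand_le Xs hr hdiff hbd hC a₀ hw.1.le ht' (eRealPt_mem_ball hx)
          rw [indicator_of_mem (mem_Ioi.2 ht.1)] at hb
          rw [← mul_assoc, norm_mul (k t * densitySeq Xs G a₀ (p + 1) t (eRealPt x)) (ψ x)]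
          exact mul_le_mul_of_nonneg_right hb (norm_nonneg _)
        · have hψ0 : ψ x = 0 := image_eq_zero_of_notMem_tsupport fun h => hx (hψ h)
          rw [hψ0]
          simp
      have hswap := integral_integral_swap hFint
      -- the remainder term of Taylor's formula
      have hrem : ∫ t in (1 : ℝ)..w, ((w : ℂ) - t) ^ p / (p ! : ℂ) * scaledPairingSeq (eb) T (Nk a₀) ψ (p + 1) t =
          -∫ x, remainderDensity Xs G a₀ p w (eRealPt x) * ψ x := by
        rw [integral_symm, integral_of_le hw.2]
        congr 1
        -- left: replace the pairing by its density and use Fubini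
        have hleft : ∫ t in Ioc w 1, ((w : ℂ) - t) ^ p / (p ! : ℂ) * scaledPairingSeq (eb) T (Nk a₀) ψ (p + 1) t =
            ∫ t in Ioc w 1, ∫ x, F t x := by
          refine setIntegral_congr_fun measurableSet_Ioc fun t ht => ?_
          have ht' : t ∈ Ioc (0 : ℝ) 1 := ⟨hw.1.trans ht.1, ht.2⟩
          rw [ha (p + 1) t ht', ← MeasureTheory.integral_const_mul]
        rw [hleft, hswap]
        refine integral_congr_ae (Eventually.of_forall fun x => ?_)
        -- right: unfold the remainder density at the real point
        have hI : Ioc (0 : ℝ) 1 ∩ Ioi w = Ioc w 1 := by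
          ext t
          simp only [mem_inter_iff, mem_Ioc, mem_Ioi]
          constructor
          · rintro ⟨⟨-, h1⟩, h2⟩; exact ⟨h2, h1⟩
          · rintro ⟨h1, h2⟩; exact ⟨⟨hw.1.trans h1, h2⟩, h1⟩
        simp only [remainderDensity]
        rw [setIntegral_indicator measurableSet_Ioi, hI, ← MeasureTheory.integral_mul_const]
        refine setIntegral_congr_fun measurableSet_Ioc fun t _ => ?_
        simp only [hF, hk]
        ring
      -- assemble
      rw [apply_translationAverage_scaleKernel_eq_taylor (eb) T (Nk a₀) ψ (hsupp a₀) p zero_lt_one hw.1,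
        Complex.ofReal_one, hpoly, hrem, ← sub_eq_add_neg, ← MeasureTheory.integral_sub]
      · refine integral_congr_ae (Eventually.of_forall fun x => ?_)
        simp only [hHw]
        ring
      · have hc : DifferentiableOn ℂ (polyDensity Xs G a₀ p w) (ball (eRealPt x₀) (r / 2)) := by
          unfold polyDensity
          refine DifferentiableOn.fun_sum fun n _ => ?_
          exact ((differentiableOn_densitySeq Xs hdiff a₀ n ⟨zero_lt_one, le_rfl⟩).mono hball).const_mul _
        exact integrable_comp_eRealPt_mul hc.continuousOn ψ hψ
      · exact integrable_comp_eRealPt_mul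
          (differentiableOn_remainderDensity Xs hr hcont hdiff hbd hC a₀ hw.1.le).continuousOn ψ hψ
    -- (B) the limit `w → 0⁺` of the right-hand side
    have hB : Tendsto (fun w : ℝ => ∫ x, Hw w (eRealPt x) * ψ x) (𝓝[>] 0)
        (𝓝 (∫ x, Hw 0 (eRealPt x) * ψ x)) := by
      have hev : ∀ᶠ w in 𝓝[>] (0 : ℝ), w ∈ Ioc (0 : ℝ) 1 := Ioc_mem_nhdsGT zero_lt_one
      -- pointwise convergence of the densities on the half polydisc
      have hlim : ∀ z ∈ ball (eRealPt x₀) (r / 2), Tendsto (fun w : ℝ => Hw w z) (𝓝[>] 0) (𝓝 (Hw 0 z)) := by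
        intro z hz
        have hpolyc : Continuous fun w : ℝ => polyDensity Xs G a₀ p w z := by
          unfold polyDensity
          fun_prop
        have hpolyt : Tendsto (fun w : ℝ => polyDensity Xs G a₀ p w z) (𝓝[>] 0)
            (𝓝 (polyDensity Xs G a₀ p 0 z)) :=
          tendsto_nhdsWithin_of_tendsto_nhds (hpolyc.tendsto 0)
        have hremt : Tendsto (fun w : ℝ => remainderDensity Xs G a₀ p w z) (𝓝[>] 0)
            (𝓝 (remainderDensity Xs G a₀ p 0 z)) := by
          unfold remainderDensity
          refine tendsto_integral_filter_of_dominated_convergence (fun _ => Brem) ?_ ?_ ?_ ?_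
          · exact Eventually.of_forall fun w => aestronglyMeasurable_remainder_integrand Xs hr hcont hdiff a₀ w hz
          · filter_upwards [hev] with w hw
            rw [ae_restrict_iff' measurableSet_Ioc]
            exact Eventually.of_forall fun t ht => hBrem ▸ norm_remainder_integrand_le Xs hr hdiff hbd hC a₀ hw.1.le ht hz
          · exact integrableOn_const (measure_Ioc_lt_top (a := (0 : ℝ)) (b := 1)).ne
          · rw [ae_restrict_iff' measurableSet_Ioc]
            refine Eventually.of_forall fun t ht => ?_
            have hft : Continuous fun w : ℝ => ((w : ℂ) - t) ^ p / (p ! : ℂ) * densitySeq Xs G a₀ (p + 1) t z := by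
              fun_prop
            have hlim0 : Tendsto (fun w : ℝ => ((w : ℂ) - t) ^ p / (p ! : ℂ) * densitySeq Xs G a₀ (p + 1) t z)
                (𝓝[>] 0) (𝓝 ((((0 : ℝ) : ℂ) - t) ^ p / (p ! : ℂ) * densitySeq Xs G a₀ (p + 1) t z)) :=
              tendsto_nhdsWithin_of_tendsto_nhds (hft.tendsto 0)
            rw [indicator_of_mem (mem_Ioi.2 ht.1)]
            refine hlim0.congr' ?_
            filter_upwards [Ioo_mem_nhdsGT ht.1] with w hw
            rw [indicator_of_mem (mem_Ioi.2 hw.2)]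
        simpa only [hHw] using hpolyt.sub hremt
      refine tendsto_integral_filter_of_dominated_convergence (fun x => (Bpoly + Brem) * ‖ψ x‖) ?_ ?_ ?_ ?_
      · filter_upwards [hev] with w hw
        have hc : DifferentiableOn ℂ (Hw w) (ball (eRealPt x₀) (r / 2)) := by
          have hpd : DifferentiableOn ℂ (polyDensity Xs G a₀ p w) (ball (eRealPt x₀) (r / 2)) := by
            unfold polyDensity
            refine DifferentiableOn.fun_sum fun n _ => ?_
            exact ((differentiableOn_densitySeq Xs hdiff a₀ n ⟨zero_lt_one, le_rfl⟩).mono hball).const_mul _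
          simp only [hHw]
          exact hpd.fun_sub (differentiableOn_remainderDensity Xs hr hcont hdiff hbd hC a₀ hw.1.le)
        exact (integrable_comp_eRealPt_mul hc.continuousOn ψ hψ).aestronglyMeasurable
      · filter_upwards [hev] with w hw
        refine Eventually.of_forall fun x => ?_
        by_cases hx : x ∈ Metric.ball x₀ (r / 2)
        · rw [norm_mul]
          exact mul_le_mul_of_nonneg_right (hHw_bd w hw.1.le hw.2 _ (eRealPt_mem_ball hx)) (norm_nonneg _)
        · have hψ0 : ψ x = 0 := image_eq_zero_of_notMem_tsupport fun h => hx (hψ h)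
          rw [hψ0]
          simp
      · exact (ψ.integrable.norm).const_mul _
      · refine Eventually.of_forall fun x => ?_
        by_cases hx : x ∈ Metric.ball x₀ (r / 2)
        · exact (hlim (eRealPt x) (eRealPt_mem_ball hx)).mul_const _
        · have hψ0 : ψ x = 0 := image_eq_zero_of_notMem_tsupport fun h => hx (hψ h)
          simp only [hψ0, mul_zero]
          exact tendsto_const_nhds
    -- (C) the limit of the left-hand side is `T ψ`
    have hC' := tendsto_apply_translationAverage_scaleKernel T (Nk a₀) ψ (hsupp a₀) hmass
    have hev : (fun w : ℝ => T (Kavg (scaleKernel w (Nk a₀)) ψ)) =ᶠ[𝓝[>] 0]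
        fun w => ∫ x, Hw w (eRealPt x) * ψ x := by
      filter_upwards [Ioc_mem_nhdsGT zero_lt_one] with w hw
      exact hA w hw
    exact tendsto_nhds_unique (hC'.congr' hev) hB

end Main

end Literature.Analysis.Complex
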